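import Mathlib
import HarnessLib
import Literature.AlgebraicGeometry.Resolution.ResolutionOfSingularities
import Summits.ResolutionOfSingularities.ResolutionOfSingularities.Theorems.WildQuotientsWildQuotientResolutionStubBirationalAlgebra

/-!
# A finite étale cover bijective on points is birational (crux `WildQuotients.WildQuotientResolution`, line `Sketch`)

Stub `stub_birational_of_bijective` — lemma (L) — of the skeleton `Sketch` for crux
stmt-ResolutionOfSingularities-15640 (route `ResolutionOfSingularities/WildQuotients`, card
`p-closure-sylow-separation`). The crux presents the quotient `X₁` of the regular `X′` by `G`
only through "`q : X′ → X₁` finite, surjective, `G`-invariant, fibres = `G`-orbits, étale over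
a dense open", NOT as `X₁ = X′/G`; every proof along the line therefore compares a genuine
quotient `Y₁ = X♯/G` with `X₁` through a morphism `r : Y₁ → X₁` which over a dense open `W` is
finite, étale and BIJECTIVE on points, and needs:

* `stub_birational_of_bijective` — over a field `k`, `r : Y₁ → X₁` a morphism of integral
  schemes, `X₁` locally of finite type over `k` and of POSITIVE dimension; if over a dense open
  `W ⊆ X₁` the restriction `r ∣_ W` is finite, étale and bijective on points, then `r` is
  birational (`Literature.AlgebraicGeometry.Resolution.IsBirational`).

The statement is false in dimension `0` (`Spec L → Spec K`, `L/K` finite separable) and over a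
henselian trait, whence the hypotheses.

Proof. Pick a non-empty affine open `U` of `W`; then `(r ∣_ W) ∣_ U : Spec B → Spec A` is finite
étale and bijective, `A`, `B` are domains (integrality), `A` is of finite type over `k`
(`LocallyOfFiniteType`), and `A` is not a field: otherwise `U` is a single point, open in `X₁`,
closed because `X₁` is Jacobson, hence `X₁` is a point, contradicting `dim X₁ > 0`
(`not_isOpen_singleton`). The commutative algebra (L-alg)
(`Birational.algebraMap_bijective_of_comap_bijective`, file `…StubBirationalAlgebra`) makes
`A → B` an isomorphism, so `r` is an isomorphism over the dense open `W.ι '' U`, whose preimage is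
a non-empty open of the irreducible `Y₁`.
-/

-- single-problem summit: the doubled namespace component `ResolutionOfSingularities` is forced
set_option linter.dupNamespace false

namespace Summit.ResolutionOfSingularities.ResolutionOfSingularities.Theorems.WildQuotientResolution.Birational

open CategoryTheory AlgebraicGeometry TopologicalSpace Literature.AlgebraicGeometry.Resolution

/-- In an irreducible Jacobson space of positive (topological Krull) dimension no point is open:
an open point is closed (Jacobson), dense (irreducibility), hence the whole space, which then has
dimension `0`. [folklore] -/
theorem not_isOpen_singleton {X : Type*} [TopologicalSpace X] [JacobsonSpace X]
    [IrreducibleSpace X] (hdim : ¬ topologicalKrullDim X ≤ 0) (x : X) :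
    ¬ IsOpen ({x} : Set X) := by
  intro hx
  have hcl : IsClosed ({x} : Set X) :=
    isClosed_singleton_of_isLocallyClosed_singleton hx.isLocallyClosed
  have hdense : Dense ({x} : Set X) := hx.dense (Set.singleton_nonempty x)
  have huniv : ({x} : Set X) = Set.univ := by rw [← hcl.closure_eq, hdense.closure_eq]
  haveI : Subsingleton X := ⟨fun a b => by
    have ha := huniv.symm ▸ Set.mem_univ a
    have hb := huniv.symm ▸ Set.mem_univ b
    rw [Set.mem_singleton_iff] at ha hb
    rw [ha, hb]⟩
  haveI : Subsingleton (IrreducibleCloseds X) := ⟨fun a b => SetLike.ext' <|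
    (Subsingleton.eq_univ_of_nonempty (s := (a : Set X)) a.isIrreducible'.nonempty).trans
      (Subsingleton.eq_univ_of_nonempty (s := (b : Set X)) b.isIrreducible'.nonempty).symm⟩
  exact hdim Order.krullDim_nonpos_of_subsingleton

/-- **Lemma (L): a finite étale cover which is bijective on points is birational** (stub
`stub_birational_of_bijective` of line `Sketch`, crux `WildQuotientResolution`). Over a field
`k`, let `r : Y₁ → X₁` be a morphism of integral schemes with `X₁` locally of finite type over
`k` and of positive dimension; if over a dense open `W ⊆ X₁` the restriction `r ∣_ W` is finite,
étale and bijective on points, then `r` is birational. Indeed `r` is an isomorphism over a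
non-empty affine open `U ⊆ W`: there `r` is `Spec B → Spec A` with `A → B` finite étale,
bijective on spectra, `A` a finite-type `k`-domain which is not a field (an open point of the
Jacobson irreducible `X₁` would be all of `X₁`), and such an `A → B` is an isomorphism
(`algebraMap_bijective_of_comap_bijective`). False in dimension `0` (`Spec L → Spec K`).
[folklore] -/
theorem stub_birational_of_bijective (k : Type) [Field k] {Y₁ X₁ : Scheme.{0}}
    (f : X₁ ⟶ Spec (.of k)) [LocallyOfFiniteType f] [IsIntegral X₁] [IsIntegral Y₁]
    (r : Y₁ ⟶ X₁) (hdim : ¬ topologicalKrullDim X₁ ≤ 0) (W : X₁.Opens)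
    (hW : Dense (W : Set X₁)) [IsFinite (r ∣_ W)] [Etale (r ∣_ W)]
    (hbij : Function.Bijective (r ∣_ W).base) : IsBirational r := by
  classical
  haveI : JacobsonSpace X₁ := LocallyOfFiniteType.jacobsonSpace f
  -- `W` and its preimage are non-empty integral schemes
  obtain ⟨x, hxW⟩ := hW.nonempty
  haveI : Nonempty (W : Scheme.{0}) := ⟨⟨x, hxW⟩⟩
  haveI : IsIntegral (W : Scheme.{0}) := isIntegral_of_isOpenImmersion W.ι
  let x0 : (W : Scheme.{0}) := ⟨x, hxW⟩
  obtain ⟨y0, hy0⟩ := hbij.2 x0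
  haveI : Nonempty (r ⁻¹ᵁ W : Scheme.{0}) := ⟨y0⟩
  haveI : IsIntegral (r ⁻¹ᵁ W : Scheme.{0}) := isIntegral_of_isOpenImmersion (r ⁻¹ᵁ W).ι
  -- an affine open neighbourhood `U` of `x0` in `W`
  obtain ⟨U, hU, hx0U, -⟩ := exists_isAffineOpen_mem_and_subset (X := (W : Scheme.{0}))
    (x := x0) (U := ⊤) trivial
  haveI : IsAffine (U : Scheme.{0}) := hU
  haveI : Nonempty (U : Scheme.{0}) := ⟨⟨x0, hx0U⟩⟩
  haveI : IsIntegral (U : Scheme.{0}) := isIntegral_of_isOpenImmersion U.ι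
  set rW := r ∣_ W with hrW
  have hy0U : y0 ∈ rW ⁻¹ᵁ U := by
    change rW.base y0 ∈ U
    rw [hy0]; exact hx0U
  haveI : Nonempty (rW ⁻¹ᵁ U : Scheme.{0}) := ⟨⟨y0, hy0U⟩⟩
  haveI : IsIntegral (rW ⁻¹ᵁ U : Scheme.{0}) := isIntegral_of_isOpenImmersion (rW ⁻¹ᵁ U).ι
  set rU := rW ∣_ U with hrU
  -- `rU` is a finite étale morphism of affine schemes, bijective on points
  obtain ⟨hVaff, hfin⟩ := (HasAffineProperty.iff_of_isAffine (P := @IsFinite)).mp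
    (inferInstance : IsFinite rU)
  have het : rU.appTop.hom.Etale := HasRingHomProperty.appTop (P := @Etale) rU inferInstance
  have hrUbij : Function.Bijective rU.base := by
    constructor
    · intro y₁ y₂ h
      apply Subtype.ext
      apply hbij.1
      have := congrArg Subtype.val h
      rwa [morphismRestrict_base_coe, morphismRestrict_base_coe] at this
    · intro u
      obtain ⟨y, hy⟩ := hbij.2 u.1
      have hyU : y ∈ rW ⁻¹ᵁ U := by
        change rW.base y ∈ U
        rw [hy]; exact u.2
      refine ⟨⟨y, hyU⟩, Subtype.ext ?_⟩
      rw [morphismRestrict_base_coe]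
      exact hy
  -- the rings `A = Γ(U)` and `B = Γ(rW⁻¹ U)`
  set A := Γ(U, ⊤) with hA
  set B := Γ(rW ⁻¹ᵁ U, ⊤) with hB
  letI : Algebra A B := rU.appTop.hom.toAlgebra
  haveI : Module.Finite A B := hfin
  haveI : Algebra.Etale A B := het
  -- the `k`-algebra structure on `A` (finite type, from `U → W → X₁ → Spec k`)
  let gU : (U : Scheme.{0}) ⟶ Spec (.of k) := U.ι ≫ W.ι ≫ f
  have hft : gU.appTop.hom.FiniteType :=
    HasRingHomProperty.appTop (P := @LocallyOfFiniteType) gU inferInstance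
  let ι₀ : k →+* Γ(Spec (.of k), ⊤) := (Scheme.ΓSpecIso (.of k)).inv.hom
  have hι₀ : Function.Bijective ι₀ :=
    ConcreteCategory.bijective_of_isIso (Scheme.ΓSpecIso (.of k)).inv
  letI : Algebra k A := (gU.appTop.hom.comp ι₀).toAlgebra
  letI : Algebra k B := ((algebraMap A B).comp (algebraMap k A)).toAlgebra
  haveI : IsScalarTower k A B := IsScalarTower.of_algebraMap_eq fun _ => rfl
  haveI : Algebra.FiniteType k A := hft.comp (RingHom.FiniteType.of_surjective ι₀ hι₀.2)
  -- `A` is not a field: otherwise `U` is one point, open in `X₁`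
  have hAf : ¬ IsField A := by
    intro hfield
    have hso := Ring.isField_iff_isSimpleOrder_ideal.mp hfield
    have hss : ∀ p q : PrimeSpectrum A, p = q := by
      intro p q
      ext1
      rcases hso.eq_bot_or_eq_top p.asIdeal with hp | hp
      · rcases hso.eq_bot_or_eq_top q.asIdeal with hq | hq
        · rw [hp, hq]
        · exact absurd hq q.2.ne_top
      · exact absurd hp p.2.ne_top
    have hsub : ∀ u : (U : Scheme.{0}), u = ⟨x0, hx0U⟩ := fun u =>
      (Scheme.homeoOfIso (U : Scheme.{0}).isoSpec).injective (hss _ _)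
    have hopen : IsOpen ({x} : Set X₁) := by
      have : ((W.ι ''ᵁ U : X₁.Opens) : Set X₁) = {x} := by
        ext z
        simp only [Scheme.Hom.coe_image, Set.mem_image, SetLike.mem_coe, Set.mem_singleton_iff]
        constructor
        · rintro ⟨w, hw, rfl⟩
          have h' : w = x0 := congrArg Subtype.val (hsub ⟨w, hw⟩)
          rw [h', Scheme.Opens.ι_apply]
        · rintro rfl
          exact ⟨x0, hx0U, rfl⟩
      rw [← this]
      exact (W.ι ''ᵁ U).2
    exact not_isOpen_singleton hdim x hopen
  -- `Spec B → Spec A` is bijective (it is `rU` up to the isomorphisms `isoSpec`)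
  have hcomap : Function.Bijective (PrimeSpectrum.comap (algebraMap A B)) := by
    have hnat := Scheme.isoSpec_hom_naturality rU
    have e1 := (Scheme.homeoOfIso (rW ⁻¹ᵁ U : Scheme.{0}).isoSpec).bijective
    have e2 := (Scheme.homeoOfIso (U : Scheme.{0}).isoSpec).bijective
    have hcomp : ⇑(Spec.map rU.appTop).base ∘ ⇑(rW ⁻¹ᵁ U : Scheme.{0}).isoSpec.hom.base =
        ⇑(U : Scheme.{0}).isoSpec.hom.base ∘ ⇑rU.base := by
      funext y
      have := congrArg (fun φ => φ.base y) hnat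
      simpa using this
    have h := e2.comp hrUbij
    rw [Scheme.coe_homeoOfIso] at h e1
    change Function.Bijective (⇑(U : Scheme.{0}).isoSpec.hom.base ∘ ⇑rU.base) at h
    rw [← hcomp, Function.Bijective.of_comp_iff _ e1] at h
    exact h
  -- the commutative algebra (L-alg): `A → B` is an isomorphism, hence so is `rU`
  have hcore := algebraMap_bijective_of_comap_bijective (k := k) hAf hcomap
  have hiso1 : IsIso rU.appTop := (ConcreteCategory.isIso_iff_bijective _).mpr hcore
  have hiso2 : IsIso rU :=
    (HasAffineProperty.iff_of_isAffine (P := MorphismProperty.isomorphisms Scheme)).mpr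
      ⟨hVaff, hiso1⟩
  have hiso3 : IsIso (r ∣_ (W.ι ''ᵁ U)) :=
    ((MorphismProperty.isomorphisms Scheme).arrow_mk_iso_iff
      (morphismRestrictRestrict r W U)).mp hiso2
  -- birational over the dense open `W.ι '' U`
  refine ⟨W.ι ''ᵁ U, ?_, ?_, hiso3⟩
  · exact (W.ι ''ᵁ U).2.dense ⟨x, ⟨x0, hx0U, rfl⟩⟩
  · refine (r ⁻¹ᵁ (W.ι ''ᵁ U)).2.dense ⟨(r ⁻¹ᵁ W).ι y0, ?_⟩
    have h1 := congrArg (fun φ => φ y0) (morphismRestrict_ι r W)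
    simp only [Scheme.Hom.comp_apply] at h1
    rw [← hrW, hy0] at h1
    show r ((r ⁻¹ᵁ W).ι y0) ∈ W.ι ''ᵁ U
    rw [← h1]
    exact ⟨x0, hx0U, rfl⟩

end Summit.ResolutionOfSingularities.ResolutionOfSingularities.Theorems.WildQuotientResolution.Birational
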